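import Literature.NumberTheory.EllipticCurves.CMTorsionGaloisImageHoldsProofs
import Literature.NumberTheory.EllipticCurves.SerreOpenImageNormalizerCaseProofs
import Literature.NumberTheory.EllipticCurves.SupersingularDensityProofs
import HarnessLib

/-!
# The mod-`ℓ` image of a CM elliptic curve over `ℚ` is not surjective for all large `ℓ`

Topic `NumberTheory/EllipticCurves`; theorems only (no definitions, no named facts).

J.-P. Serre, Invent. Math. 15 (1972), §4.5 (the CM case of the open image paper): for an elliptic
curve `E/ℚ` with complex multiplication the image of `ρ̄_{E,ℓ} : Γ_ℚ → Aut(E[ℓ]) ≅ GL₂(𝔽_ℓ)` lies,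
for every large prime `ℓ`, in the normaliser of a Cartan subgroup, hence is NEVER the whole of
`GL₂(𝔽_ℓ)` (sharp form: D. Zywina, arXiv:1508.07660, Prop. 1.14 and 1.16 — every odd `ℓ`; the
tree's cite-only fact `zywina2015_cm_modEll_not_surjective`).  This file proves the qualitative
statement from theorems of the tree:

* `exists_bound_forall_not_hasSurjectiveModNGaloisRep_of_hasCM` — there is `L₀` such that for
  every elliptic `W/ℚ` with (geometric) CM and every prime `ℓ > L₀`,
  `¬ W.HasSurjectiveModNGaloisRep ℓ`.

Proof.  The main theorem of complex multiplication on `ℓ`-torsion in the tree's form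
(`cmTorsion_cartanImage_holds`, Lang, *Elliptic Functions*, Ch. 10 §4) supplies, beyond a
threshold `L₀`, an endomorphism `φ = √D` of `E[ℓ]` with `φ² = D`, `ℓ ∤ D`, `φ` no scalar, twisted
by the quadratic character `χ` of the CM field: `φ(σP) = χ(σ)·σφ(P)`.  In a frame
`E[ℓ] ≅ 𝔽_ℓ²` (`exists_frame_galoisRepTorsion_rat`) its matrix `Φ` is a non-scalar square root of
`D ≠ 0` and every `ρ̄(σ)` commutes or anti-commutes with `Φ` (`exists_matrix_sqrt_frame`: the
image normalises the Cartan subgroup `𝔽_ℓ[Φ]ˣ`).  But for `ℓ` odd the transvection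
`T = (1 1; 0 1)` neither commutes nor anti-commutes with such a `Φ`
(`transvection_not_comm_not_anticomm`: a direct `2 × 2` computation), so `T` is not in the image
and `ρ̄_{E,ℓ}` is not onto (`map_range_galoisRepTorsion_eq_top_iff`).

* `exists_goodOrdinary_not_hasSurjectiveModNGaloisRep_of_hasCM` — corollary with the infinitude
  of good ordinary primes (`infinite_goodOrdinaryPrimes_holds`, Deuring): a globally minimal CM
  curve over `ℚ` has a good ordinary prime `p ≥ 5` at which `ρ̄_{E,p}` is not surjective — the
  "small-image prime supply" for CM curves consumed summit-side
  (`Summits/BirchSwinnertonDyer/…/Theorems/TangentConeSelmerRankSmallImageCMKernel.lean`).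

## References

* [Serre1972] J.-P. Serre, *Propriétés galoisiennes des points d'ordre fini des courbes
  elliptiques*, Invent. Math. 15 (1972) 259–331, §4.5 (and §2.2 for Cartan normalisers).
* [Zywina2015] D. Zywina, *On the possible images of the mod ℓ representations associated to
  elliptic curves over ℚ*, arXiv:1508.07660, §1.9, Prop. 1.14, Prop. 1.16.
* [Lang1987] S. Lang, *Elliptic Functions*, 2nd ed., GTM 112 (1987), Ch. 10 §4.
-/

noncomputable section

open scoped Classical MatrixGroups
open Matrix Field

namespace Literature.NumberTheory.EllipticCurves

open _root_.WeierstrassCurve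

/-! ### A transvection is outside the normaliser of every Cartan subgroup (`2 ≠ 0`) -/

/-- **The transvection `T = (1 1; 0 1)` neither commutes nor anti-commutes with a non-scalar
square root `Φ` of a non-zero scalar `D`, in characteristic `≠ 2`.**  (Commuting forces `Φ`
upper triangular with equal diagonal entries, then `Φ² = D` and `2 ≠ 0` force `Φ` scalar or
`D = 0`; anti-commuting forces `Φ = 0`, so `D = 0`.)  Serre 1972, §2.2 ("tout élément de `N - C`
est d'ordre 2 modulo le centre" — a transvection is not). [cite: Serre1972, §2.2] -/
theorem transvection_not_comm_not_anticomm {F : Type*} [Field F] (h2 : (2 : F) ≠ 0)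
    {Φ : Matrix (Fin 2) (Fin 2) F} {D : F} (hΦ : Φ * Φ = D • (1 : Matrix (Fin 2) (Fin 2) F))
    (hD : D ≠ 0) (hns : ∀ c : F, Φ ≠ c • 1) :
    Φ * !![(1 : F), 1; 0, 1] ≠ !![(1 : F), 1; 0, 1] * Φ ∧
      Φ * !![(1 : F), 1; 0, 1] ≠ -(!![(1 : F), 1; 0, 1] * Φ) := by
  obtain ⟨x, y, z, w, rfl⟩ : ∃ x y z w : F, Φ = !![x, y; z, w] :=
    ⟨Φ 0 0, Φ 0 1, Φ 1 0, Φ 1 1, Matrix.eta_fin_two Φ⟩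
  -- the four entries of `Φ² = D`
  have h00 := congrFun (congrFun hΦ 0) 0
  have h01 := congrFun (congrFun hΦ 0) 1
  have h11 := congrFun (congrFun hΦ 1) 1
  simp only [Matrix.mul_apply, Fin.sum_univ_two, Matrix.of_apply, Matrix.cons_val',
    Matrix.cons_val_zero, Matrix.cons_val_one, Matrix.empty_val', Matrix.cons_val_fin_one,
    Matrix.smul_apply, Matrix.one_apply_eq, Matrix.one_apply_ne (show (0 : Fin 2) ≠ 1 by decide),
    smul_eq_mul, mul_one, mul_zero] at h00 h01 h11
  constructor
  · intro h
    have e00 := congrFun (congrFun h 0) 0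
    have e01 := congrFun (congrFun h 0) 1
    have e11 := congrFun (congrFun h 1) 1
    simp only [Matrix.mul_apply, Fin.sum_univ_two, Matrix.of_apply, Matrix.cons_val',
      Matrix.cons_val_zero, Matrix.cons_val_one, Matrix.empty_val', Matrix.cons_val_fin_one,
      mul_one, mul_zero, one_mul, zero_mul, add_zero, zero_add] at e00 e01 e11
    -- `e00 : x = x + z`, `e01 : x + y = y + w`, `e11 : z + w = w`
    have hz : z = 0 := by linear_combination e11
    have hw : w = x := by linear_combination -e01
    -- now `Φ = (x y; 0 x)`: `x*y + y*x = 0` and `x*x = D`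
    have hxy : (2 : F) * (x * y) = 0 := by
      rw [hw] at h01
      linear_combination h01
    rcases mul_eq_zero.mp ((mul_eq_zero.mp hxy).resolve_left h2) with hx | hy
    · rw [hx, hz] at h00
      exact hD (by linear_combination -h00)
    · refine hns x ?_
      rw [hy, hz, hw]
      ext i j
      fin_cases i <;> fin_cases j <;> simp
  · intro h
    have e00 := congrFun (congrFun h 0) 0
    have e01 := congrFun (congrFun h 0) 1
    have e10 := congrFun (congrFun h 1) 0
    have e11 := congrFun (congrFun h 1) 1
    simp only [Matrix.mul_apply, Fin.sum_univ_two, Matrix.of_apply, Matrix.cons_val',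
      Matrix.cons_val_zero, Matrix.cons_val_one, Matrix.empty_val', Matrix.cons_val_fin_one,
      Matrix.neg_apply, mul_one, mul_zero, one_mul, zero_mul, add_zero, zero_add] at e00 e01 e10 e11
    -- `e00 : x = -(x + z)`, `e01 : x + y = -(y + w)`, `e10 : z = -z`, `e11 : z + w = -w`
    have hz : (2 : F) * z = 0 := by linear_combination e10
    have hz0 : z = 0 := (mul_eq_zero.mp hz).resolve_left h2
    have hx : (2 : F) * x = 0 := by linear_combination e00 - hz0
    have hx0 : x = 0 := (mul_eq_zero.mp hx).resolve_left h2
    have hw : (2 : F) * w = 0 := by linear_combination e11 - hz0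
    have hw0 : w = 0 := (mul_eq_zero.mp hw).resolve_left h2
    have hy : (2 : F) * y = 0 := by linear_combination e01 - hx0 - hw0
    have hy0 : y = 0 := (mul_eq_zero.mp hy).resolve_left h2
    subst hz0 hx0 hw0 hy0
    exact hD (by linear_combination -h00)

/-! ### Serre 1972, §4.5: CM curves have small mod-`ℓ` image for all large `ℓ` -/

/-- **Serre 1972, §4.5 (qualitative CM case); Zywina 2015, Prop. 1.14/1.16.**  There is a bound
`L₀` such that for every elliptic curve `W/ℚ` with (geometric) complex multiplication and every
prime `ℓ > L₀` the mod-`ℓ` Galois representation `ρ̄_{E,ℓ} : Γ_ℚ → Aut(E[ℓ])` is NOT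
surjective.  From the tree's main theorem of complex multiplication on `ℓ`-torsion
(`cmTorsion_cartanImage_holds`: a non-scalar `φ = √D`, `ℓ ∤ D`, twisted by the CM character),
the frame `E[ℓ] ≅ 𝔽_ℓ²` (`exists_frame_galoisRepTorsion_rat`, `exists_matrix_sqrt_frame`: the
image commutes or anti-commutes with the matrix `Φ` of `φ`), and
`transvection_not_comm_not_anticomm` (the transvection `(1 1; 0 1)` does neither, `ℓ` odd).
[cite: Serre1972, §4.5] -/
theorem exists_bound_forall_not_hasSurjectiveModNGaloisRep_of_hasCM :
    ∃ L₀ : ℕ, ∀ (W : WeierstrassCurve ℚ) [W.IsElliptic], W.HasCM →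
      ∀ ℓ : ℕ, ℓ.Prime → L₀ < ℓ → ¬ W.HasSurjectiveModNGaloisRep ℓ := by
  obtain ⟨L₀, hL⟩ := cmTorsion_cartanImage_holds
  refine ⟨max L₀ 2, fun W _ hW ℓ hℓ hlt hsurj ↦ ?_⟩
  have hL₀ℓ : L₀ < ℓ := lt_of_le_of_lt (le_max_left _ _) hlt
  have h2ℓ : 2 < ℓ := lt_of_le_of_lt (le_max_right _ _) hlt
  haveI : Fact ℓ.Prime := ⟨hℓ⟩
  have h2 : (2 : ZMod ℓ) ≠ 0 := by
    intro h0
    have : ℓ ∣ 2 := (ZMod.natCast_eq_zero_iff 2 ℓ).mp (by exact_mod_cast h0)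
    exact absurd (Nat.le_of_dvd two_pos this) (by omega)
  obtain ⟨φ, D, χ, hφ, hD, hns, -, htw, -⟩ := hL W hW ℓ hℓ hL₀ℓ
  obtain ⟨e, Φfr, he, -, -, -, -⟩ := exists_frame_galoisRepTorsion_rat W ℓ
  obtain ⟨Φ, -, hΦsq, hΦns, hdich⟩ := exists_matrix_sqrt_frame W ℓ e Φfr he hφ hns htw
  have hD' : ((D : ℤ) : ZMod ℓ) ≠ 0 := by
    rwa [Ne, ZMod.intCast_zmod_eq_zero_iff_dvd]
  obtain ⟨hc, ha⟩ := transvection_not_comm_not_anticomm h2 hΦsq hD' hΦns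
  -- the transvection lies in the (full) image
  have hdetT : Matrix.det !![(1 : ZMod ℓ), 1; 0, 1] ≠ 0 := by
    simp [Matrix.det_fin_two]
  set T : GL (Fin 2) (ZMod ℓ) := Matrix.GeneralLinearGroup.mkOfDetNeZero _ hdetT with hT
  have hTmem : T ∈ (galoisRepTorsion W ℓ).range.map Φfr.toMonoidHom := by
    rw [(map_range_galoisRepTorsion_eq_top_iff W ℓ Φfr).mpr hsurj]
    exact Subgroup.mem_top T
  obtain ⟨σ, hσ⟩ := (mem_map_range_galoisRepTorsion_iff W ℓ Φfr).mp hTmem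
  have hTval : ((Φfr (galoisRepTorsion W ℓ σ) : GL (Fin 2) (ZMod ℓ)) :
      Matrix (Fin 2) (Fin 2) (ZMod ℓ)) = !![(1 : ZMod ℓ), 1; 0, 1] := by
    rw [hσ, hT]
    rfl
  rcases hdich σ with ⟨h, -⟩ | ⟨h, -⟩
  · exact hc (by rwa [hTval] at h)
  · exact ha (by rwa [hTval] at h)

/-! ### Corollary: the small-image prime supply for CM curves at good ordinary primes -/

/-- **A globally minimal CM curve over `ℚ` has a good ordinary prime `p ≥ 5` with non-surjective
mod-`p` image** (indeed infinitely many: the good ordinary primes are infinite —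
`infinite_goodOrdinaryPrimes_holds`, Deuring — and beyond Serre's CM threshold every prime has
small image, `exists_bound_forall_not_hasSurjectiveModNGaloisRep_of_hasCM`).  This is the
"small-image prime supply" that makes the BSD crux `SelmerRankSmallImage` CONTAIN rank BSD for CM
curves. [cite: Serre1972, §4.5] -/
theorem exists_goodOrdinary_not_hasSurjectiveModNGaloisRep_of_hasCM (W : WeierstrassCurve ℚ)
    [W.IsElliptic] [W.IsGloballyMinimal] (hW : W.HasCM) :
    ∃ (p : ℕ) (_ : Fact p.Prime), 5 ≤ p ∧ W.HasGoodReductionAtPrime p ∧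
      ¬ (p : ℤ) ∣ W.frobeniusTrace p ∧ ¬ W.HasSurjectiveModNGaloisRep p := by
  obtain ⟨L₀, hL⟩ := exists_bound_forall_not_hasSurjectiveModNGaloisRep_of_hasCM
  obtain ⟨p, ⟨hp, hgood, hord⟩, hlt⟩ :=
    (infinite_goodOrdinaryPrimes_holds W).exists_gt (max L₀ 4)
  have h5 : 5 ≤ p := by
    have := le_max_right L₀ 4
    omega
  have hL₀p : L₀ < p := lt_of_le_of_lt (le_max_left _ _) hlt
  exact ⟨p, hp, h5, hgood, hord, hL W hW p hp.out hL₀p⟩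

end Literature.NumberTheory.EllipticCurves

end
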